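import Summits.ValiantsHypothesis.ValiantsHypothesis.Theses.Depth4

/-!
# Strategist r1 (second opinion) — typed census pieces for crux `Depth4HomFour`
(item stmt-ValiantsHypothesis-11333, route route-ValiantsHypothesis-Depth4)

Companion of `STRATEGY-CENSUS.md` (r1). Everything here elaborates; the theorems marked PROVED are
sorry-free; the `def … : Prop` pieces are the census's switches, TYPED so that later seats can
probe / prove / refute them by name. Nothing here is a registered line.

Contents
* §1 `summit_of_X` — the certified strengthening `X → ValiantsHypothesis` (= the route's `closes`).
* §2 CIRCULARITY SCHEMA (PROVED, pure logic): for ANY notion `Small c n` ("per_n has a circuit of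
  the c-th size bound") and ANY notion `Good c' n` ("per_n has a GOOD circuit of the c'-th bound"),
  the conditional circuit-side statement `CS := ∀ c ∃ c' n₀ ∀ n ≥ n₀, Small c n → Good c' n` is
  implied by the eventual crux `Ev := ∀ c ∃ n₀ ∀ n ≥ n₀, ¬ Small c n`; hence for every polynomial
  side `PS` with `PS → CS → Ev` one has `PS → (CS ↔ Ev)`: EVERY split of the crux of the shape
  "polynomial side + conditional circuit side" has its circuit side equal to the (eventual) crux
  modulo the polynomial side (lead c2's "generic lesson", Lines/birth-dead.md §4, now
  kernel-checked in general). `X_iff_io` instantiates `Small`.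
* §3 REAL FORM: `XReal` (the crux over `ℝ`-circuits), `ComplexEmbedding`, `Realification`
  (Lagrange interpolation in an auxiliary variable realifies a hom ΣΠΣΠ circuit at cost `(n+1)×`),
  with `XReal_of_X`, `X_of_XReal` PROVED from them.
* §4 MONOTONE (ε-SENSITIVE) FORM at depth four: monotone hom ΣΠΣΠ circuits (`IsMonotone`),
  `monHomDepthFourCircuitSize`, the masked permanent `R·(Σ x_ij)^n + per_n`, the switch
  `XMon := ∀ c ∃ n ∀ R ≥ 0, (n+2)^(c√n+c) < monHomDepthFourCircuitSize (masked n R)`, the two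
  transfer statements `MonotoneTransfer` (Hrubeš 2020 Lemma 22/23 + Ben-Or interpolation, kept at
  depth FOUR — census §Transfer T7) and `MonotoneEmbedding` (subtract the mask: trivial), and the
  compositions `X_of_XMon`, `XMon_of_XReal` PROVED. `XMonBdd ρ` is the bounded-mask fragment
  (the only regime where an ε-sensitive engine exists in print; barrier
  `Literature.Barriers.ValiantsHypothesis.MonotoneGap`).
-/

namespace Summit.ValiantsHypothesis.ValiantsHypothesis.Cruxes.Depth4HomFour.StrategistR1

open Literature.Computability.AlgebraicComplexity
open MvPolynomial

/-- The crux, by name (`Crux`; `X` in the census prose). -/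
abbrev Crux : Prop := Summit.ValiantsHypothesis.ValiantsHypothesis.Theses.Depth4.Depth4HomFour

/-! ## §1 The certified strengthening -/

/-- PROVED (it is the route's deciding theorem `closes`): the crux implies the summit. -/
theorem summit_of_X : Crux → _root_.ValiantsHypothesis :=
  Summit.ValiantsHypothesis.ValiantsHypothesis.Theses.Depth4.closes

/-! ## §2 Circularity schema -/

section Schema

variable (Small Good : ℕ → ℕ → Prop)

/-- Eventual (a.e.) form: for every `c`, for all large `n`, NOT `Small c n`. -/
def Ev : Prop := ∀ c : ℕ, ∃ n₀ : ℕ, ∀ n : ℕ, n₀ ≤ n → ¬ Small c n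

/-- Infinitely-often form: for every `c` some `n` has NOT `Small c n` (the crux's shape). -/
def IO : Prop := ∀ c : ℕ, ∃ n : ℕ, ¬ Small c n

/-- Conditional circuit side: small circuits can be made GOOD at the cost of the constant. -/
def CS : Prop := ∀ c : ℕ, ∃ c' n₀ : ℕ, ∀ n : ℕ, n₀ ≤ n → Small c n → Good c' n

/-- PROVED: the eventual form implies the infinitely-often form. [folklore] -/
theorem io_of_ev : Ev Small → IO Small := by
  intro h c
  obtain ⟨n₀, h⟩ := h c
  exact ⟨n₀, h n₀ le_rfl⟩

/-- PROVED: the eventual crux implies EVERY conditional circuit-side statement outright (its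
antecedent is eventually false; take `c' = 0`). [folklore] -/
theorem cs_of_ev : Ev Small → CS Small Good := by
  intro h c
  obtain ⟨n₀, h⟩ := h c
  exact ⟨0, n₀, fun n hn hs => absurd hs (h n hn)⟩

/-- PROVED (the schema): if a polynomial side `PS` glues with the circuit side to the eventual
crux, then MODULO `PS` the circuit side IS the eventual crux. [folklore] -/
theorem cs_iff_ev_of (PS : Prop) (glue : PS → CS Small Good → Ev Small) (hPS : PS) :
    CS Small Good ↔ Ev Small :=
  ⟨glue hPS, cs_of_ev Small Good⟩

end Schema

/-- The instance of `Small` for this crux: `per_n` has a homogeneous depth-4 circuit over `ℂ` with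
at most `(n+2)^(c⌊√n⌋+c)` gates. -/
def SmallC (c n : ℕ) : Prop :=
  homDepthFourCircuitSize (perPoly (Fin n) ℂ) ≤ ((n + 2 : ℕ∞) ^ (c * Nat.sqrt n + c))

/-- PROVED: the crux is literally the infinitely-often form for `SmallC`. -/
theorem X_iff_io : Crux ↔ IO SmallC := by
  unfold Crux Summit.ValiantsHypothesis.ValiantsHypothesis.Theses.Depth4.Depth4HomFour IO SmallC
  simp only [not_le]

/-- PROVED: the eventual crux implies the crux. -/
theorem X_of_ev : Ev SmallC → Crux := fun h => X_iff_io.2 (io_of_ev SmallC h)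

/-! ## §3 The real form -/

/-- The crux for circuits over `ℝ` (the permanent has integer coefficients). -/
def XReal : Prop :=
  ∀ c : ℕ, ∃ n : ℕ, ((n + 2 : ℕ∞) ^ (c * Nat.sqrt n + c)) <
    homDepthFourCircuitSize (perPoly (Fin n) ℝ)

/-- A real homogeneous depth-4 circuit for `per_n` is a complex one (`ArithCircuit.map` along
`ℝ →+* ℂ`, `map_perPoly`). Routine. -/
def ComplexEmbedding : Prop :=
  ∀ n : ℕ, homDepthFourCircuitSize (perPoly (Fin n) ℂ) ≤ homDepthFourCircuitSize (perPoly (Fin n) ℝ)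

/-- REALIFICATION (census §Transfer, free normal form): a homogeneous ΣΠΣΠ circuit over `ℂ` of size
`S` for the real polynomial `per_n` yields a REAL one of size `≤ (n+2)^a · S`: write each bottom
sparse polynomial as `A + iB`, each top product as `g(i)` with `g(z) = Π_j (A_j + z B_j) ∈ ℝ[x][z]`
of degree `≤ n` in `z`, and take `Re g(i)` as a real Lagrange combination of `g(z_0), …, g(z_n)` at
real nodes — `(n+1)` real products per complex product, no `2^D` sign expansion. Stated in exponent
currency. [cite: Ben-Or interpolation trick, cf. Hrubes2020 §4.1 (ii)] -/
def Realification : Prop :=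
  ∃ a : ℕ, ∀ n b : ℕ, homDepthFourCircuitSize (perPoly (Fin n) ℂ) ≤ ((n + 2 : ℕ∞) ^ b) →
    homDepthFourCircuitSize (perPoly (Fin n) ℝ) ≤ ((n + 2 : ℕ∞) ^ (b + a))

/-- `1 ≤ n + 2` in `ℕ∞`. -/
theorem hbase {n : ℕ} : (1 : ℕ∞) ≤ (n + 2 : ℕ∞) := le_add_left (by norm_num)

/-- PROVED: the complex crux implies the real one, given the embedding. -/
theorem XReal_of_X (hE : ComplexEmbedding) : Crux → XReal := by
  intro h c
  obtain ⟨n, hn⟩ := h c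
  exact ⟨n, lt_of_lt_of_le hn (hE n)⟩

/-- Exponent bookkeeping used twice below: `a * (c * s + c + 1) ≤ (a*c + a) * s + (a*c + a)`. -/
theorem exp_bookkeeping (a c s : ℕ) : a * (c * s + c + 1) ≤ (a * c + a) * s + (a * c + a) := by
  nlinarith [Nat.zero_le (a * s)]

/-- PROVED: the real crux implies the complex one, given realification. -/
theorem X_of_XReal (hR : Realification) : XReal → Crux := by
  intro h c
  obtain ⟨a, ha⟩ := hR
  obtain ⟨n, hn⟩ := h (c + a)
  refine ⟨n, ?_⟩
  by_contra hle
  rw [not_lt] at hle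
  have h1 := ha n (c * Nat.sqrt n + c) hle
  have h2 : ((n + 2 : ℕ∞) ^ (c * Nat.sqrt n + c + a)) ≤
      ((n + 2 : ℕ∞) ^ ((c + a) * Nat.sqrt n + (c + a))) := by
    apply pow_le_pow_right₀ hbase
    nlinarith [Nat.zero_le (a * Nat.sqrt n)]
  exact absurd (lt_of_le_of_lt h2 (lt_of_lt_of_le hn h1)) (lt_irrefl _)

/-! ## §4 The monotone (ε-sensitive) form at depth four -/

section Monotone

variable {σ : Type}

/-- A real operand is nonnegative if it is a variable, a gate reference, or a constant `≥ 0`. -/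
def OperandNonneg : ArithCircuit.Operand ℝ σ → Prop
  | .const c => 0 ≤ c
  | _ => True

/-- A gate is monotone if all its sum weights and constant operands are `≥ 0`. -/
def GateMonotone : ArithCircuit.Gate ℝ σ → Prop
  | .sum args => ∀ a ∈ args, 0 ≤ a.1 ∧ OperandNonneg a.2
  | .prod args => ∀ u ∈ args, OperandNonneg u

/-- MONOTONE real circuit (Hrubeš 2020 §2: "all the constants are non-negative"), in the tree's
weighted unbounded-fan-in model. [cite: Hrubes2020, §2] -/
def IsMonotone (P : ArithCircuit ℝ σ) : Prop :=
  ∀ g ∈ P.gates, GateMonotone g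

/-- Least gate count of a MONOTONE homogeneous depth-4 real circuit computing `f` (`⊤` if none). -/
noncomputable def monHomDepthFourCircuitSize (f : MvPolynomial σ ℝ) : ℕ∞ :=
  ⨅ (P : ArithCircuit ℝ σ)
    (_ : P.Computes f ∧ P.IsDepthFour ∧ P.IsHomogeneousCircuit ∧ IsMonotone P), (P.size : ℕ∞)

/-- Dropping monotonicity: the general measure is below the monotone one. PROVED. -/
theorem homDepthFourCircuitSize_le_mon (f : MvPolynomial σ ℝ) :
    homDepthFourCircuitSize f ≤ monHomDepthFourCircuitSize f :=
  le_iInf₂ fun _ hP => homDepthFourCircuitSize_le hP.1 hP.2.1 hP.2.2.1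

end Monotone

/-- The masked permanent `R · (Σ_{ij} x_ij)^n + per_n` over `ℝ` (Hrubeš's universal polynomial in
its homogeneous form `L^n`, `L = Σ x_ij`). -/
noncomputable def maskedPer (n : ℕ) (R : ℝ) : MvPolynomial (Fin n × Fin n) ℝ :=
  C R * (∑ v : Fin n × Fin n, X v) ^ n + perPoly (Fin n) ℝ

/-- THE MONOTONE SWITCH `XMon`: for every `c` some `n` has, for EVERY mask weight `R ≥ 0`, no
monotone homogeneous ΣΠΣΠ circuit of size `≤ (n+2)^(c⌊√n⌋+c)` for `R·L^n + per_n`. Equivalent to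
the crux by `X_of_XMon` / `XMon_of_XReal` given the two transfers below. -/
def XMon : Prop :=
  ∀ c : ℕ, ∃ n : ℕ, ∀ R : ℝ, 0 ≤ R →
    ((n + 2 : ℕ∞) ^ (c * Nat.sqrt n + c)) < monHomDepthFourCircuitSize (maskedPer n R)

/-- The BOUNDED-MASK fragment of `XMon` (masks `R ≤ ρ n` only) — the regime of the discrepancy
engines (CDM 2021, CDGM 2022), which need `ε = 1/R ≥ 2^{-O(n)}` and are blind to `VP` versus `VNP`
(barrier `Literature.Barriers.ValiantsHypothesis.MonotoneGap.not_sensitiveTransfer_of_le`). A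
WEAKENING of `XMon`, not a piece of it. -/
def XMonBdd (ρ : ℕ → ℝ) : Prop :=
  ∀ c : ℕ, ∃ n : ℕ, ∀ R : ℝ, 0 ≤ R → R ≤ ρ n →
    ((n + 2 : ℕ∞) ^ (c * Nat.sqrt n + c)) < monHomDepthFourCircuitSize (maskedPer n R)

/-- PROVED: the bounded fragment is weaker. -/
theorem xMonBdd_of_xMon (ρ : ℕ → ℝ) : XMon → XMonBdd ρ := by
  intro h c
  obtain ⟨n, hn⟩ := h c
  exact ⟨n, fun R hR _ => hn R hR⟩

/-- MONOTONE TRANSFER AT DEPTH FOUR (census §Transfer T7; Hrubeš 2020 Thm 1 / Lemma 22–23 with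
two changes that keep the depth at four): if `per_n` has a homogeneous ΣΠΣΠ circuit over `ℂ` with at
most `(n+2)^b` gates then for some `R ≥ 0` the masked permanent `R·L^n + per_n` has a MONOTONE
homogeneous ΣΠΣΠ real circuit with at most `(n+2)^(a(b+1))` gates (`a` absolute). Proof sketch:
realify (`Realification`); Ben-Or split `f = f₊ − f₋` by Lagrange interpolation of
`Π_j (Q_j⁺ + z Q_j⁻)` at `D+1` positive nodes (monotone ΣΠΣΠ, `(D+1)×`); Hrubeš's telescoping
`L^d − x^α = Σ_t x_{α,<t} (L − x_{α_t}) L^{d−t}` and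
`Π_j r_j L^{d_j} − Π_j G_j = Σ_j (Π_{i<j} G_i)(r_j L^{d_j} − G_j)(Π_{i>j} r_i L^{d_i})`, DISTRIBUTED
so that every summand is a product of sparse polynomials, variables and the degree-1 sparse
polynomials `L`, `L − x_v`: a monotone ΠΣΠ term — depth four, `poly(S, n)` terms.
[cite: Hrubes2020, Thm 1, Lemma 22, Lemma 23, §4.1 (ii)] -/
def MonotoneTransfer : Prop :=
  ∃ a : ℕ, ∀ n b : ℕ, homDepthFourCircuitSize (perPoly (Fin n) ℂ) ≤ ((n + 2 : ℕ∞) ^ b) →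
    ∃ R : ℝ, 0 ≤ R ∧ monHomDepthFourCircuitSize (maskedPer n R) ≤ ((n + 2 : ℕ∞) ^ (a * (b + 1)))

/-- MONOTONE EMBEDDING (trivial direction): a monotone circuit for `R·L^n + per_n` with `≤ (n+2)^b`
gates gives a real homogeneous ΣΠΣΠ circuit for `per_n` with `≤ (n+2)^(b+2)` gates (append the sum
gate `L`, the product gate `L^n`, and the weight `−R` into the output sum: `+3` gates, merged into
the top Σ so the ΣΠ-depth stays `4`). [cite: Hrubes2020, §2, remark after Thm 1] -/
def MonotoneEmbedding : Prop :=
  ∀ (n : ℕ) (R : ℝ), 0 ≤ R → ∀ b : ℕ,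
    monHomDepthFourCircuitSize (maskedPer n R) ≤ ((n + 2 : ℕ∞) ^ b) →
      homDepthFourCircuitSize (perPoly (Fin n) ℝ) ≤ ((n + 2 : ℕ∞) ^ (b + 2))

/-- PROVED: the monotone switch implies the crux, given the depth-4 monotone transfer. -/
theorem X_of_XMon (hT : MonotoneTransfer) : XMon → Crux := by
  intro h c
  obtain ⟨a, ha⟩ := hT
  obtain ⟨n, hn⟩ := h (a * c + a)
  refine ⟨n, ?_⟩
  by_contra hle
  rw [not_lt] at hle
  obtain ⟨R, hR, hmon⟩ := ha n (c * Nat.sqrt n + c) hle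
  have h2 : ((n + 2 : ℕ∞) ^ (a * (c * Nat.sqrt n + c + 1))) ≤
      ((n + 2 : ℕ∞) ^ ((a * c + a) * Nat.sqrt n + (a * c + a))) :=
    pow_le_pow_right₀ hbase (exp_bookkeeping a c (Nat.sqrt n))
  exact absurd (lt_of_le_of_lt h2 (lt_of_lt_of_le (hn R hR) hmon)) (lt_irrefl _)

/-- PROVED: the real crux implies the monotone switch, given the embedding. -/
theorem XMon_of_XReal (hE : MonotoneEmbedding) : XReal → XMon := by
  intro h c
  obtain ⟨n, hn⟩ := h (c + 2)
  refine ⟨n, fun R hR => ?_⟩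
  by_contra hle
  rw [not_lt] at hle
  have h1 := hE n R hR (c * Nat.sqrt n + c) hle
  have h2 : ((n + 2 : ℕ∞) ^ (c * Nat.sqrt n + c + 2)) ≤
      ((n + 2 : ℕ∞) ^ ((c + 2) * Nat.sqrt n + (c + 2))) := by
    apply pow_le_pow_right₀ hbase
    nlinarith [Nat.zero_le (Nat.sqrt n)]
  exact absurd (lt_of_le_of_lt h2 (lt_of_lt_of_le hn h1)) (lt_irrefl _)

/-- PROVED: the full circle — given the three transfer facts, `X`, `XReal` and `XMon` are
equivalent; so the monotone language is EXACT for this crux (and therefore inherits its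
difficulty: census §Transfer T7, §Negation N4). -/
theorem X_iff_XMon (hR : Realification) (hE : ComplexEmbedding) (hT : MonotoneTransfer)
    (hM : MonotoneEmbedding) : (Crux ↔ XMon) ∧ (Crux ↔ XReal) :=
  ⟨⟨fun h => XMon_of_XReal hM (XReal_of_X hE h), X_of_XMon hT⟩,
   ⟨XReal_of_X hE, X_of_XReal hR⟩⟩

end Summit.ValiantsHypothesis.ValiantsHypothesis.Cruxes.Depth4HomFour.StrategistR1
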